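import Summits.QuantumFields.GaugeBoot.DiagonalRPTorusRestJetClusters
import HarnessLib

/-!
# Replica cluster integrals on the doubled torus (gauge-boot, L3 `d = 3` uniform window, brick 6c)

HONEST FRAMING (cell `pub-gaugeboot`, page 1 of every file): the venture produces certified bounds
on lattice expectations at stated coupling, gauge group, dimension and torus size; NOT a mass gap,
NOT a continuum limit, NOT a string tension; NOT Yang–Mills-summit-bearing (barriers
`FixedCouplingUltralocality`, `PerturbativeInvisibility`). This module is measure-theoretic
transport for the replica cluster integrals of `DiagonalRPTorusRestJetClusters`; it discharges
nothing by itself.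

## Content (torus `(ℤ/L)^d`, compact metrisable `G`, continuous `ρ`)

The replica cluster integral `DiagRPUnif.replicaTerm ρ f g Q z` is an integral over the Literature's
doubled Haar product `dblHaar d G` on ALL bonds of `ℤ^d` (two copies), of an integrand reading
both replicas through the section `torusSigma L`. Here it is brought to the finite doubled torus:

* `dblSect L : Edge d L ⊕ Edge d L → DblEdge d` (injective) and ★ `map_torusSigmaPair_dblHaar`:
  the law of `(torusSigma L W.fst, torusSigma L W.snd)` under `dblHaar` is the product
  `π ⊗ π` of two torus Haar products (`Measure.map_infinitePi_infinitePi_of_inj`,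
  `measurePreserving_sumPiEquivProdPi`); `integral_dblHaar_eq_integral_prod`.
* torus-side weights `tweight z q V = e^{-z (N - Re tr ρ(V_q))} - 1` and
  `tdweight z q (V, V') = (1 + tweight z q V)(1 + tweight z q V') - 1`
  (`dblWeight_tlab`: the Literature's `dblWeight` of the label `tlab q` read through the section);
  gauge invariance `plaqRe_gaugeTransform`, `tweight_gaugeTransform`; bounds.
* ★ `replicaTerm_eq_integral_prod`:
  `replicaTerm Q z = ∫ (f V - f V') (g V - g V') ∏_{q ∈ Q} tdweight z q (V, V') d(π ⊗ π)(V, V')`.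

The sequel `DiagonalRPTorusReplicaForest` proves the DOUBLED FOREST PRINCIPLE on `π ⊗ π`
(a replica cluster integral vanishes identically when the cluster splits along a gauge-fixable
interface), the tool that makes the combinatorial crux of the `d = 3` leg a statement about SETS
of plaquettes. Elementary; no named fact.
-/

open MeasureTheory Finset Function

namespace Summit.QuantumFields.GaugeBoot

open Literature.MathematicalPhysics.QuantumFieldTheory

noncomputable section

namespace DiagRPUnif

open DiagRPTube

/-! ## The doubled section and the law of the two torus replicas -/

section Transport

variable {d L : ℕ} {G : Type*}

/-- The doubled section: both copies of the torus links into the doubled bonds of `ℤ^d`. -/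
def dblSect (L : ℕ) : Edge d L ⊕ Edge d L → DblEdge d :=
  Sum.elim (fun e => (torusSect L e, false)) (fun e => (torusSect L e, true))

/-- The doubled section is injective. -/
theorem dblSect_injective [NeZero L] : Injective (dblSect (d := d) L) := by
  rintro (e | e) (e' | e') h
  · simp only [dblSect, Sum.elim_inl, Prod.mk.injEq, and_true] at h
    rw [torusSect_injective h]
  · simp [dblSect] at h
  · simp [dblSect] at h
  · simp only [dblSect, Sum.elim_inr, Prod.mk.injEq, and_true] at h
    rw [torusSect_injective h]

/-- Both replicas read on the torus: `W ↦ (torusSigma L W.fst, torusSigma L W.snd)`. -/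
def torusSigmaPair (L : ℕ) (W : DblConfig d G) : GaugeConfig d L G × GaugeConfig d L G :=
  (torusSigma L W.fst, torusSigma L W.snd)

/-- `torusSigmaPair` is the restriction along `dblSect` followed by `sumPiEquivProdPi`. -/
theorem torusSigmaPair_eq [MeasurableSpace G] (L : ℕ) (W : DblConfig d G) :
    torusSigmaPair L W =
      MeasurableEquiv.sumPiEquivProdPi (fun _ : Edge d L ⊕ Edge d L => G)
        (fun i => W (dblSect L i)) := by
  rw [MeasurableEquiv.coe_sumPiEquivProdPi]
  rfl

/-- `torusSigmaPair` is measurable. -/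
theorem measurable_torusSigmaPair [MeasurableSpace G] (L : ℕ) :
    Measurable (torusSigmaPair (d := d) (G := G) L) :=
  (measurable_torusSigma L).comp DblConfig.measurable_fst |>.prodMk
    ((measurable_torusSigma L).comp DblConfig.measurable_snd)

variable [MeasurableSpace G] [Group G] [TopologicalSpace G] [IsTopologicalGroup G] [CompactSpace G]
  [BorelSpace G]

/-- ★ **The law of the two torus replicas under the doubled Haar product is the product of two
torus Haar products.** -/
theorem map_torusSigmaPair_dblHaar [NeZero L] :
    (dblHaar d G).map (torusSigmaPair L) =
      (Measure.pi fun _ : Edge d L => haarProbability G).prod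
        (Measure.pi fun _ : Edge d L => haarProbability G) := by
  have hmeas : Measurable fun (W : DblConfig d G) (i : Edge d L ⊕ Edge d L) => W (dblSect L i) :=
    measurable_pi_lambda _ fun i => measurable_pi_apply _
  have hfun : torusSigmaPair (d := d) (G := G) L =
      (MeasurableEquiv.sumPiEquivProdPi (fun _ : Edge d L ⊕ Edge d L => G)) ∘
        fun W i => W (dblSect L i) := funext fun W => torusSigmaPair_eq L W
  rw [hfun, ← Measure.map_map (MeasurableEquiv.measurable _) hmeas]
  have h1 : (dblHaar d G).map
      (fun (W : DblConfig d G) (i : Edge d L ⊕ Edge d L) => W (dblSect L i)) =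
      Measure.pi fun _ : Edge d L ⊕ Edge d L => haarProbability G := by
    have h := Measure.map_infinitePi_infinitePi_of_inj (P := fun _ : DblEdge d => haarProbability G)
      (dblSect_injective (d := d) (L := L))
    rw [← Measure.infinitePi_eq_pi]
    exact h
  rw [h1]
  exact (measurePreserving_sumPiEquivProdPi fun _ : Edge d L ⊕ Edge d L => haarProbability G).map_eq

/-- **Integrals of (complex) functions of the two torus replicas** are integrals over `π ⊗ π`. -/
theorem integral_dblHaar_eq_integral_prod [NeZero L]
    {Φ : GaugeConfig d L G × GaugeConfig d L G → ℂ} (hΦ : Measurable Φ) :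
    ∫ W, Φ (torusSigmaPair L W) ∂dblHaar d G =
      ∫ p, Φ p ∂(Measure.pi fun _ : Edge d L => haarProbability G).prod
        (Measure.pi fun _ : Edge d L => haarProbability G) := by
  rw [← map_torusSigmaPair_dblHaar, integral_map (measurable_torusSigmaPair L).aemeasurable
    hΦ.aestronglyMeasurable]

end Transport

/-! ## Torus-side weights -/

section Weights

variable {d L : ℕ} [NeZero L] {N : ℕ} {G : Type*} [Group G] (ρ : G →* Matrix (Fin N) (Fin N) ℂ)

/-- The plaquette weight at complex coupling, read on the torus:
`tweight z q V = e^{-z (N - Re tr ρ(V_q))} - 1`. -/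
def tweight (z : ℂ) (q : Plaquette d L) (V : GaugeConfig d L G) : ℂ :=
  Complex.exp (-(z * (((N : ℝ) - WilsonRP.plaqRe ρ V q : ℝ) : ℂ))) - 1

/-- The doubled weight `(1 + f_q(V))(1 + f_q(V')) - 1`. -/
def tdweight (z : ℂ) (q : Plaquette d L) (p : GaugeConfig d L G × GaugeConfig d L G) : ℂ :=
  (1 + tweight ρ z q p.1) * (1 + tweight ρ z q p.2) - 1

/-- The Literature weight of the label `tlab q` is the torus weight read through the section. -/
theorem weight_tlab (z : ℂ) (q : Plaquette d L) (U : ZdGaugeConfig d G) :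
    (torusSystem ρ L).weight z (tlab q) U = tweight ρ z q (torusSigma L U) := by
  simp only [PlaqSystem.weight, torusSystem_cost, torusCost_tlab, tweight]

/-- The Literature doubled weight of `tlab q` is the torus doubled weight of the two replicas. -/
theorem dblWeight_tlab (z : ℂ) (q : Plaquette d L) (W : DblConfig d G) :
    (torusSystem ρ L).dblWeight z (tlab q) W = tdweight ρ z q (torusSigmaPair L W) := by
  simp only [PlaqSystem.dblWeight, weight_tlab, tdweight, torusSigmaPair]

omit [NeZero L] in
/-- The doubled weight is symmetric in the two replicas. -/
theorem tdweight_swap (z : ℂ) (q : Plaquette d L) (V V' : GaugeConfig d L G) :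
    tdweight ρ z q (V', V) = tdweight ρ z q (V, V') := by
  simp only [tdweight]; ring

omit [NeZero L] in
/-- **Gauge invariance of plaquette values** (conjugation covariance of the holonomy and
cyclicity of the trace). -/
theorem plaqRe_gaugeTransform (γ : Site d L → G) (V : GaugeConfig d L G) (q : Plaquette d L) :
    WilsonRP.plaqRe ρ (gaugeTransform γ V) q = WilsonRP.plaqRe ρ V q := by
  unfold WilsonRP.plaqRe
  rw [Literature.MathematicalPhysics.QuantumLattice.plaquetteHolonomy_gaugeTransform, map_mul,
    map_mul,
    Matrix.trace_mul_cycle, ← map_mul, inv_mul_cancel, map_one, one_mul]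

omit [NeZero L] in
/-- The torus weight is gauge invariant. -/
theorem tweight_gaugeTransform (z : ℂ) (q : Plaquette d L) (γ : Site d L → G)
    (V : GaugeConfig d L G) :
    tweight ρ z q (gaugeTransform γ V) = tweight ρ z q V := by
  simp only [tweight, plaqRe_gaugeTransform]

omit [NeZero L] in
/-- The torus weight reads only the links of its plaquette. -/
theorem dependsOn_tweight (z : ℂ) (q : Plaquette d L) :
    DependsOn (tweight ρ z q : GaugeConfig d L G → ℂ) (plinks q : Set (Edge d L)) := by
  intro V V' h
  simp only [tweight]
  rw [plaqRe_congr ρ q (U := V) (V := V') fun a => h _ (mem_coe.2 (link_mem_plinks q a))]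

variable [TopologicalSpace G] [IsTopologicalGroup G] [CompactSpace G]

omit [NeZero L] in
/-- `‖tweight z q V‖ ≤ e^{2 N ‖z‖} + 1`. -/
theorem norm_tweight_le (hρ : Continuous ρ) (z : ℂ) (q : Plaquette d L) (V : GaugeConfig d L G) :
    ‖tweight ρ z q V‖ ≤ Real.exp (2 * N * ‖z‖) + 1 := by
  unfold tweight
  refine (norm_sub_le _ _).trans (add_le_add ?_ (by simp))
  rw [Complex.norm_exp]
  refine Real.exp_le_exp.2 ?_
  have h1 : (-(z * (((N : ℝ) - WilsonRP.plaqRe ρ V q : ℝ) : ℂ))).re ≤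
      ‖z * (((N : ℝ) - WilsonRP.plaqRe ρ V q : ℝ) : ℂ)‖ := by
    refine (Complex.re_le_norm _).trans ?_
    rw [norm_neg]
  refine h1.trans ?_
  rw [norm_mul, Complex.norm_real, Real.norm_eq_abs]
  have h2 : |(N : ℝ) - WilsonRP.plaqRe ρ V q| ≤ 2 * N := by
    have := WilsonRP.abs_plaqRe_le ρ hρ V q
    rw [abs_le] at this ⊢
    constructor <;> linarith [this.1, this.2]
  nlinarith [norm_nonneg z]

variable [MeasurableSpace G] [BorelSpace G] [SecondCountableTopology G]

omit [CompactSpace G] in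
/-- The torus weight is measurable (continuous `ρ`, second-countable `G`). -/
theorem measurable_tweight (hρ : Continuous ρ) (z : ℂ) (q : Plaquette d L) :
    Measurable (tweight ρ z q : GaugeConfig d L G → ℂ) := by
  unfold tweight
  refine (Complex.measurable_exp.comp ?_).sub measurable_const
  exact (measurable_const.mul (Complex.measurable_ofReal.comp
    (measurable_const.sub (continuous_plaqRe ρ hρ q).measurable))).neg

omit [CompactSpace G] in
/-- The doubled weight is measurable. -/
theorem measurable_tdweight (hρ : Continuous ρ) (z : ℂ) (q : Plaquette d L) :
    Measurable (tdweight ρ z q : GaugeConfig d L G × GaugeConfig d L G → ℂ) := by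
  unfold tdweight
  exact ((measurable_const.add ((measurable_tweight ρ hρ z q).comp measurable_fst)).mul
    (measurable_const.add ((measurable_tweight ρ hρ z q).comp measurable_snd))).sub measurable_const

end Weights

/-! ## The replica cluster integral on the doubled torus -/

section Replica

variable {d L : ℕ} [NeZero L] {N : ℕ} {G : Type*} [Group G] [TopologicalSpace G]
  [IsTopologicalGroup G] [CompactSpace G] [MeasurableSpace G] [BorelSpace G]
  [SecondCountableTopology G] (ρ : G →* Matrix (Fin N) (Fin N) ℂ)

/-- The replica integrand on the doubled torus. -/
def replicaIntegrand (f g : GaugeConfig d L G → ℝ) (Q : Finset (Plaquette d L)) (z : ℂ)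
    (p : GaugeConfig d L G × GaugeConfig d L G) : ℂ :=
  (((f p.1 : ℝ) : ℂ) - f p.2) * (((g p.1 : ℝ) : ℂ) - g p.2) * ∏ q ∈ Q, tdweight ρ z q p

omit [CompactSpace G] in
/-- The replica integrand is measurable. -/
theorem measurable_replicaIntegrand (hρ : Continuous ρ) {f g : GaugeConfig d L G → ℝ}
    (hfm : Measurable f) (hgm : Measurable g) (Q : Finset (Plaquette d L)) (z : ℂ) :
    Measurable (replicaIntegrand ρ f g Q z) := by
  unfold replicaIntegrand
  refine (((Complex.measurable_ofReal.comp (hfm.comp measurable_fst)).sub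
    (Complex.measurable_ofReal.comp (hfm.comp measurable_snd))).mul
    ((Complex.measurable_ofReal.comp (hgm.comp measurable_fst)).sub
    (Complex.measurable_ofReal.comp (hgm.comp measurable_snd)))).mul ?_
  exact Finset.measurable_prod _ fun q _ => measurable_tdweight ρ hρ z q

/-- ★ **The replica cluster integral is an integral over the doubled torus `π ⊗ π`.** -/
theorem replicaTerm_eq_integral_prod (hρ : Continuous ρ) {f g : GaugeConfig d L G → ℝ}
    (hfm : Measurable f) (hgm : Measurable g) (Q : Finset (Plaquette d L)) (z : ℂ) :
    replicaTerm ρ f g Q z =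
      ∫ p, replicaIntegrand ρ f g Q z p ∂(Measure.pi fun _ : Edge d L => haarProbability G).prod
        (Measure.pi fun _ : Edge d L => haarProbability G) := by
  rw [← integral_dblHaar_eq_integral_prod (measurable_replicaIntegrand ρ hρ hfm hgm Q z)]
  unfold replicaTerm replicaIntegrand
  refine integral_congr_ae (ae_of_all _ fun W => ?_)
  simp only [PlaqSystem.dblWeightProd, torusSigmaPair]
  rw [prod_image fun q _ q' _ h => tlab_injective h]
  simp only [dblWeight_tlab, torusSigmaPair]

end Replica

end DiagRPUnif

end

end Summit.QuantumFields.GaugeBoot
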